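import Literature.Probability.RandomPlanarGeometry.HexSAWBrickWallStripFugacityLevel0
import HarnessLib

/-!
# The narrowest strip: `μ_0(y,1) = √y` (the one-row strip `S_0` of the brick wall)

[B-BM-dG-DC-G14] N. R. Beaton, M. Bousquet-Mélou, J. de Gier, H. Duminil-Copin, A. J. Guttmann, *The critical fugacity
for surface adsorption of self-avoiding walks on the honeycomb lattice is `1 + √2`*, Comm. Math. Phys. **326** (2014),
arXiv:1109.0358v5 — §3.2, Proposition 6 (p. 10: the strip growth rates `μ_T(y,z)`), Corollary 8 (p. 12: the thresholds `y_T`).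

An exact evaluation at the bottom of the printed one-level tower `HexBW.stripMuY₀` of
`HexSAWBrickWallStripFugacityLevel0.lean` (not in print; the lane's): the strip `S_0 = ℤ × {0}` of the brick wall
carries no vertical bond, so an `N`-step self-avoiding walk confined to it is a monotone run along the row, its
level-`0` vertices (odd abscissa) are every other site, and

* `HexBW.card_stripPairs_zero_le : #(stripPairs 0 N) ≤ 4` (`N ≥ 1`: two starting classes × two directions),
* `HexBW.two_mul_bottomVisits₀_bounds : N ≤ 2·bc(ω) ≤ N + 2` for every walk of `S_N(S_0)`,
* `HexBW.stripZ₀_zero_le`, `HexBW.le_stripZ₀_zero` : `min(1,y)·y^{N/2} ≤ C_{0,N}(y,1) ≤ 4·max(1,y)·y^{N/2}`,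
* **`HexBW.stripMuY₀_zero : μ_0(y,1) = √y`** (`y > 0`).

Consequently the first printed-type threshold is explicit: `μ_0(y,1) = μ = √(2+√2) ⟺ y = 2 + √2`, i.e. `y'_0 = 2 + √2` for
the threshold `HexBW.stripYT₀ 0` of `HexSAWStripSurfaceYT.lean` (= the lane's `HV.stripYT 1` by `HexSAWStripSurfaceFrameBridge.lean`);
that corollary is drawn in `HexSAWStripSurfaceYTOne.lean`, which imports the threshold files. This file imports the tree's
`…Level0` only.
-/

noncomputable section

open Filter Topology Finset Literature.Probability.LatticeModels Literature.Probability.Percolation SimpleGraph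

namespace Literature.Probability.RandomPlanarGeometry.SAW.HexBW

variable {N : ℕ} {p q : Site 2 × (ℕ → Site 2)} {y : ℝ}

/-! ### Walks confined to the row `S_0` -/

/-- Two sites of `ℤ²` with equal coordinates are equal. [folklore]
[cite: DuminilCopinSmirnov2012, §3 (the strip S_T of the hexagonal lattice; here in its brick-wall embedding in ℤ², a site has two integer coordinates); lane plumbing] -/
private theorem site_ext {x z : Site 2} (h0 : x 0 = z 0) (h1 : x 1 = z 1) : x = z :=
  funext fun j => (Fin.forall_fin_two (p := fun j => x j = z j)).2 ⟨h0, h1⟩ j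

/-- In `S_0` every site of a placed walk lies on the row `x₁ = 0`. [cite: MadrasSlade1993, §8.2, eq. (8.2.1) (S_T = ℤ × {0,…,T})] -/
theorem row_eq_zero_of_mem_stripPairs_zero (hp : p ∈ stripPairs 0 N) {m : ℕ} (hm : m ≤ N) :
    (p.1 + p.2 m) 1 = 0 := by
  have h := (mem_stripPairs.1 hp).2.2.2 m hm
  unfold InStrip at h
  push_cast at h
  omega

/-- The starting class of a walk of `S_N(S_0)`: `a = (0,0)` or `(1,0)`. [cite: MadrasSlade1993, §8.2, eq. (8.2.1)] -/
theorem start_of_mem_stripPairs_zero (hp : p ∈ stripPairs 0 N) : (p.1 0 = 0 ∨ p.1 0 = 1) ∧ p.1 1 = 0 := by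
  have h := mem_stripStarts.1 (mem_stripPairs.1 hp).1
  unfold InStrip at h
  push_cast at h
  omega

/-- The translate part starts at the origin. [cite: MadrasSlade1993, §1.1] -/
theorem snd_zero_of_mem_stripPairs (hp : p ∈ stripPairs 0 N) : p.2 0 = 0 :=
  (Zd.mem_saws.1 (mem_stripPairs.1 hp).2.1).1

/-- The translate part is frozen after time `N`. [cite: MadrasSlade1993, §1.1] -/
theorem snd_frozen_of_mem_stripPairs (hp : p ∈ stripPairs 0 N) {i : ℕ} (hi : N ≤ i) : p.2 i = p.2 N :=
  (Zd.mem_saws.1 (mem_stripPairs.1 hp).2.1).2.1 i hi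

/-- The translate part is injective on `[0, N]`. [cite: MadrasSlade1993, §1.1] -/
theorem snd_injOn_of_mem_stripPairs (hp : p ∈ stripPairs 0 N) : Set.InjOn p.2 {i | i ≤ N} :=
  (Zd.mem_saws.1 (mem_stripPairs.1 hp).2.1).2.2.2

/-- `S_0` has no vertical bond: consecutive sites of a walk of `S_N(S_0)` differ by a horizontal unit step.
[cite: EntingJensen2009, §7.4.2, Fig. 7.10 (brickwork form of the honeycomb lattice)] -/
theorem step_of_mem_stripPairs_zero (hp : p ∈ stripPairs 0 N) {i : ℕ} (hi : i < N) :
    p.2 (i + 1) 0 = p.2 i 0 + 1 ∨ p.2 (i + 1) 0 + 1 = p.2 i 0 := by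
  have hadj : brickWallGraph.Adj (p.1 + p.2 i) (p.1 + p.2 (i + 1)) := (mem_stripPairs.1 hp).2.2.1 i hi
  have h0 := row_eq_zero_of_mem_stripPairs_zero hp hi.le
  have h1 := row_eq_zero_of_mem_stripPairs_zero hp (m := i + 1) (by omega)
  rw [brickWallGraph_adj_coord] at hadj
  simp only [Pi.add_apply] at hadj h0 h1
  omega

/-- The second coordinate of the translate part vanishes along the walk. [cite: MadrasSlade1993, §8.2, eq. (8.2.1)] -/
theorem snd_apply_one_of_mem_stripPairs_zero (hp : p ∈ stripPairs 0 N) {m : ℕ} (hm : m ≤ N) : p.2 m 1 = 0 := by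
  have h := row_eq_zero_of_mem_stripPairs_zero hp hm
  have ha := (start_of_mem_stripPairs_zero hp).2
  simp only [Pi.add_apply] at h
  omega

/-- **Parity along the row**: after `m` steps the abscissa has the parity of `a₀ + m`. [cite: MadrasSlade1993, §1.1 (bipartite parity of ℤ^d walks)] -/
theorem parity_of_mem_stripPairs_zero (hp : p ∈ stripPairs 0 N) :
    ∀ m ≤ N, (p.1 + p.2 m) 0 % 2 = (p.1 0 + m) % 2 := by
  intro m
  induction m with
  | zero =>
    intro _
    simp [Pi.add_apply, snd_zero_of_mem_stripPairs hp]
  | succ m ih =>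
    intro hm
    have h := step_of_mem_stripPairs_zero hp (Nat.lt_of_succ_le hm)
    have ih' := ih (Nat.le_of_succ_le hm)
    simp only [Pi.add_apply] at ih' ⊢
    push_cast
    omega

/-- The direction of the first step is `±1` (`N ≥ 1`). [cite: MadrasSlade1993, §1.1] -/
theorem dir_of_mem_stripPairs_zero (hp : p ∈ stripPairs 0 N) (hN : 1 ≤ N) : p.2 1 0 = 1 ∨ p.2 1 0 = -1 := by
  have h := step_of_mem_stripPairs_zero hp (i := 0) hN
  have h00 : p.2 0 0 = 0 := by simp [snd_zero_of_mem_stripPairs hp]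
  simp only [Nat.zero_add, h00] at h
  omega

/-- **The walks of `S_N(S_0)` are monotone runs**: with `s = ±1` the direction of the first step,
`υ(i+1)₀ = υ(i)₀ + s` for all `i < N` (a reversal would revisit the previous site). [cite: MadrasSlade1993, §1.1] -/
theorem snd_succ_of_mem_stripPairs_zero (hp : p ∈ stripPairs 0 N) :
    ∀ i, i + 1 ≤ N → p.2 (i + 1) 0 = p.2 i 0 + p.2 1 0 := by
  intro i
  induction i with
  | zero =>
    intro _
    simp [snd_zero_of_mem_stripPairs hp]
  | succ i ih =>
    intro hi
    have hA := step_of_mem_stripPairs_zero hp (i := i + 1) (by omega)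
    have hB := ih (by omega)
    have hC := dir_of_mem_stripPairs_zero hp (by omega)
    have hD : p.2 (i + 1 + 1) 0 ≠ p.2 i 0 := by
      intro h
      have h1a := snd_apply_one_of_mem_stripPairs_zero hp (m := i + 1 + 1) hi
      have h1b := snd_apply_one_of_mem_stripPairs_zero hp (m := i) (by omega)
      have heq : p.2 (i + 1 + 1) = p.2 i := site_ext h (by rw [h1a, h1b])
      have := snd_injOn_of_mem_stripPairs hp (show i + 1 + 1 ∈ {i | i ≤ N} from hi)
        (show i ∈ {i | i ≤ N} by simp only [Set.mem_setOf_eq]; omega) heq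
      omega
    omega

/-- Closed form of the run: `υ(i)₀ = s·i` for `i ≤ N`. [cite: MadrasSlade1993, §1.1] -/
theorem snd_apply_zero_of_mem_stripPairs_zero (hp : p ∈ stripPairs 0 N) :
    ∀ i ≤ N, p.2 i 0 = p.2 1 0 * i := by
  intro i
  induction i with
  | zero => intro _; simp [snd_zero_of_mem_stripPairs hp]
  | succ i ih =>
    intro hi
    rw [snd_succ_of_mem_stripPairs_zero hp i hi, ih (by omega)]
    push_cast
    ring

/-- A walk of `S_N(S_0)` is determined by its starting class and the direction of its first step (`N ≥ 1`).
[cite: MadrasSlade1993, §8.2] -/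
theorem injOn_start_dir_stripPairs_zero (N : ℕ) :
    Set.InjOn (fun p : Site 2 × (ℕ → Site 2) => (p.1, p.2 1 0)) ↑(stripPairs 0 N) := by
  intro p hp q hq h
  simp only [Finset.mem_coe] at hp hq
  simp only [Prod.mk.injEq] at h
  obtain ⟨ha, hs⟩ := h
  have hle : ∀ i ≤ N, p.2 i = q.2 i := fun i hi =>
    site_ext (by rw [snd_apply_zero_of_mem_stripPairs_zero hp i hi, snd_apply_zero_of_mem_stripPairs_zero hq i hi, hs])
      (by rw [snd_apply_one_of_mem_stripPairs_zero hp hi, snd_apply_one_of_mem_stripPairs_zero hq hi])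
  refine Prod.ext ha (funext fun i => ?_)
  by_cases hi : i ≤ N
  · exact hle i hi
  · have hi' : N ≤ i := by omega
    rw [snd_frozen_of_mem_stripPairs hp hi', snd_frozen_of_mem_stripPairs hq hi', hle N le_rfl]

/-- **`#S_N(S_0) ≤ 4`** for `N ≥ 1` (in fact `= 4`: two starting classes, two directions).
[cite: MadrasSlade1993, §8.2 (c_N(S_T))] -/
theorem card_stripPairs_zero_le (hN : 1 ≤ N) : (stripPairs 0 N).card ≤ 4 := by
  have h := Finset.card_le_card_of_injOn (fun p : Site 2 × (ℕ → Site 2) => (p.1, p.2 1 0))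
    (s := stripPairs 0 N) (t := stripStarts 0 ×ˢ ({1, -1} : Finset ℤ)) (fun p hp => by
      simp only [Finset.mem_coe] at hp
      simp only [Finset.mem_coe, Finset.mem_product, Finset.mem_insert, Finset.mem_singleton]
      exact ⟨(mem_stripPairs.1 hp).1, dir_of_mem_stripPairs_zero hp hN⟩) (injOn_start_dir_stripPairs_zero N)
  rw [Finset.card_product, card_stripStarts, Finset.card_pair (by norm_num)] at h
  simpa using h

/-! ### The level-`0` visit count on the row: every other site -/

/-- The number of odd integers among `a, a+1, …, a+N` (= the bottom contacts of a straight run on the row `S_0`). [folklore]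
[cite: BeatonBousquetMelouDeGierDuminilCopinGuttmann2014, §3.2 (arXiv v5 p. 10: the walks confined to the strip S_T and their bottom contacts bc(ω) in C_{T,k}(y,z)); lane bookkeeping, not in print] -/
def oddCount (a : ℤ) (N : ℕ) : ℕ := ∑ m ∈ range (N + 1), if (a + m) % 2 = 1 then 1 else 0

/-- Two more consecutive integers contain exactly one more odd one. [folklore]
[cite: BeatonBousquetMelouDeGierDuminilCopinGuttmann2014, §3.2 (arXiv v5 p. 10: the walks confined to the strip S_T and their bottom contacts bc(ω) in C_{T,k}(y,z)); lane bookkeeping, not in print] -/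
theorem oddCount_add_two (a : ℤ) (N : ℕ) : oddCount a (N + 2) = oddCount a N + 1 := by
  unfold oddCount
  rw [show N + 2 + 1 = N + 1 + 1 + 1 from rfl, Finset.sum_range_succ, Finset.sum_range_succ, add_assoc]
  congr 1
  push_cast
  split_ifs <;> omega

/-- `N ≤ 2·oddCount a N ≤ N + 2`. [folklore]
[cite: BeatonBousquetMelouDeGierDuminilCopinGuttmann2014, §3.2 (arXiv v5 p. 10: the walks confined to the strip S_T and their bottom contacts bc(ω) in C_{T,k}(y,z)); lane bookkeeping, not in print] -/
theorem oddCount_bounds (a : ℤ) : ∀ N : ℕ, N ≤ 2 * oddCount a N ∧ 2 * oddCount a N ≤ N + 2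
  | 0 => by
    unfold oddCount
    simp only [zero_add, Finset.sum_range_one]
    push_cast
    split_ifs <;> omega
  | 1 => by
    unfold oddCount
    rw [Finset.sum_range_succ, Finset.sum_range_one]
    push_cast
    split_ifs <;> omega
  | N + 2 => by
    have := oddCount_bounds a N
    rw [oddCount_add_two]
    omega

/-- On `S_0` the level-`0` visit count is the odd count of the run of abscissae `a₀, a₀ ± 1, …`:
`bc(ω) = oddCount a₀ N`. [cite: BeatonBousquetMelouDeGierDuminilCopinGuttmann2014, §3.2 (arXiv v5 p. 10: bc(ω), the contacts with the bottom of the strip)] -/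
theorem bottomVisits₀_eq_oddCount (hp : p ∈ stripPairs 0 N) : bottomVisits₀ p.1 p.2 N = oddCount (p.1 0) N := by
  unfold bottomVisits₀ oddCount
  refine Finset.sum_congr rfl fun m hm => ?_
  have hm' : m ≤ N := Nat.lt_succ_iff.1 (Finset.mem_range.1 hm)
  have h1 := row_eq_zero_of_mem_stripPairs_zero hp hm'
  have h2 := parity_of_mem_stripPairs_zero hp m hm'
  by_cases hc : (p.1 0 + m) % 2 = 1
  · rw [if_pos ⟨h1, by rw [h2, hc]⟩, if_pos hc]
  · rw [if_neg (fun h => hc (by rw [← h2]; exact h.2)), if_neg hc]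

/-- **`N ≤ 2·bc(ω) ≤ N + 2`** for every walk of `S_N(S_0)`: the level-`0` vertices are every other site of the run.
[cite: BeatonBousquetMelouDeGierDuminilCopinGuttmann2014, §3.2 (arXiv v5 p. 10)] -/
theorem two_mul_bottomVisits₀_bounds (hp : p ∈ stripPairs 0 N) :
    N ≤ 2 * bottomVisits₀ p.1 p.2 N ∧ 2 * bottomVisits₀ p.1 p.2 N ≤ N + 2 := by
  rw [bottomVisits₀_eq_oddCount hp]
  exact oddCount_bounds _ N

/-! ### The explicit run to the right -/

/-- The `N`-step run to the right from the origin, frozen after time `N`. [cite: MadrasSlade1993, §1.1] -/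
def lineWalk (N : ℕ) : ℕ → Site 2 := fun i => ![((min i N : ℕ) : ℤ), 0]

/-- Abscissa of the straight run. [cite: BeatonBousquetMelouDeGierDuminilCopinGuttmann2014, §3.2 (arXiv v5 p. 10: the walks confined to the strip S_T and their bottom contacts bc(ω) in C_{T,k}(y,z)); lane bookkeeping, not in print] -/
@[simp] theorem lineWalk_apply_zero (N i : ℕ) : lineWalk N i 0 = ((min i N : ℕ) : ℤ) := rfl
/-- The straight run stays on the row `S_0`. [cite: BeatonBousquetMelouDeGierDuminilCopinGuttmann2014, §3.2 (arXiv v5 p. 10: the walks confined to the strip S_T and their bottom contacts bc(ω) in C_{T,k}(y,z)); lane bookkeeping, not in print] -/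
@[simp] theorem lineWalk_apply_one (N i : ℕ) : lineWalk N i 1 = 0 := rfl

/-- Consecutive sites of the run are brick-wall neighbours. [cite: EntingJensen2009, §7.4.2, Fig. 7.10] -/
theorem lineWalk_adj {N i : ℕ} (hi : i < N) : brickWallGraph.Adj (lineWalk N i) (lineWalk N (i + 1)) := by
  rw [brickWallGraph_adj_coord]
  left
  refine ⟨Or.inl ?_, by simp⟩
  simp only [lineWalk_apply_zero, Nat.min_eq_left hi.le, Nat.min_eq_left (Nat.succ_le_of_lt hi)]
  push_cast
  ring

/-- The run is a self-avoiding walk of `ℤ²`. [cite: MadrasSlade1993, §1.1] -/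
theorem lineWalk_mem_saws (N : ℕ) : lineWalk N ∈ Zd.saws 2 N := by
  rw [Zd.mem_saws]
  refine ⟨site_ext (by simp) (by simp), fun i hi => site_ext (by simp [Nat.min_eq_right hi]) (by simp),
    fun i hi => zd_adj_of_adj (lineWalk_adj hi), ?_⟩
  intro i hi j hj h
  simp only [Set.mem_setOf_eq] at hi hj
  have h0 := congrFun h 0
  simp only [lineWalk_apply_zero, Nat.min_eq_left hi, Nat.min_eq_left hj] at h0
  exact_mod_cast h0

/-- The run, started at the class `(0,0)`, is a walk of `S_N(S_0)`. [cite: MadrasSlade1993, §8.2] -/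
theorem lineWalk_mem_stripPairs_zero (N : ℕ) : ((0 : Site 2), lineWalk N) ∈ stripPairs 0 N := by
  rw [mem_stripPairs]
  refine ⟨mem_stripStarts.2 ⟨⟨le_rfl, zero_le_one⟩, le_rfl, by simp⟩, lineWalk_mem_saws N, ?_, ?_⟩
  · intro i hi
    simpa only [zero_add] using lineWalk_adj hi
  · intro m _
    refine ⟨?_, ?_⟩ <;> simp

/-! ### Two-sided bounds on `C_{0,N}(y,1)` and the value of `μ_0(y,1)` -/

/-- The weight of a single walk of `S_N(S_0)`: `min(1,y)·y^{N/2} ≤ y^{bc(ω)} ≤ max(1,y)·y^{N/2}` (`y > 0`).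
[cite: BeatonBousquetMelouDeGierDuminilCopinGuttmann2014, §3.2 (arXiv v5 p. 10)] -/
theorem pow_bottomVisits₀_bounds (hp : p ∈ stripPairs 0 N) (hy : 0 < y) :
    min 1 y * y ^ ((N : ℝ) / 2) ≤ y ^ bottomVisits₀ p.1 p.2 N ∧
      y ^ bottomVisits₀ p.1 p.2 N ≤ max 1 y * y ^ ((N : ℝ) / 2) := by
  obtain ⟨hlo, hhi⟩ := two_mul_bottomVisits₀_bounds hp
  set v := bottomVisits₀ p.1 p.2 N with hv
  have hlo' : (N : ℝ) / 2 ≤ (v : ℝ) := by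
    have : (N : ℝ) ≤ 2 * (v : ℝ) := by exact_mod_cast hlo
    linarith
  have hhi' : (v : ℝ) ≤ (N : ℝ) / 2 + 1 := by
    have : 2 * (v : ℝ) ≤ (N : ℝ) + 2 := by exact_mod_cast hhi
    linarith
  have hyN : 0 < y ^ ((N : ℝ) / 2) := Real.rpow_pos_of_pos hy _
  rw [← Real.rpow_natCast]
  rcases le_or_gt 1 y with hy1 | hy1
  · rw [min_eq_left hy1, max_eq_right hy1, one_mul]
    refine ⟨Real.rpow_le_rpow_of_exponent_le hy1 hlo', ?_⟩
    calc y ^ (v : ℝ) ≤ y ^ ((N : ℝ) / 2 + 1) := Real.rpow_le_rpow_of_exponent_le hy1 hhi'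
      _ = y * y ^ ((N : ℝ) / 2) := by rw [Real.rpow_add hy, Real.rpow_one, mul_comm]
  · rw [min_eq_right hy1.le, max_eq_left hy1.le, one_mul]
    refine ⟨?_, Real.rpow_le_rpow_of_exponent_ge hy hy1.le hlo'⟩
    calc y * y ^ ((N : ℝ) / 2) = y ^ ((N : ℝ) / 2 + 1) := by rw [Real.rpow_add hy, Real.rpow_one, mul_comm]
      _ ≤ y ^ (v : ℝ) := Real.rpow_le_rpow_of_exponent_ge hy hy1.le hhi'

/-- **`C_{0,N}(y,1) ≤ 4·max(1,y)·y^{N/2}`** (`N ≥ 1`, `y > 0`). [cite: BeatonBousquetMelouDeGierDuminilCopinGuttmann2014, §3.2 (arXiv v5 p. 10)] -/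
theorem stripZ₀_zero_le (hN : 1 ≤ N) (hy : 0 < y) : stripZ₀ 0 N y ≤ 4 * (max 1 y * y ^ ((N : ℝ) / 2)) := by
  unfold stripZ₀
  have hM : 0 ≤ max 1 y * y ^ ((N : ℝ) / 2) :=
    mul_nonneg (zero_le_one.trans (le_max_left 1 y)) (Real.rpow_nonneg hy.le _)
  calc ∑ p ∈ stripPairs 0 N, y ^ bottomVisits₀ p.1 p.2 N
      ≤ ∑ p ∈ stripPairs 0 N, max 1 y * y ^ ((N : ℝ) / 2) :=
        Finset.sum_le_sum fun p hp => (pow_bottomVisits₀_bounds hp hy).2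
    _ = (stripPairs 0 N).card * (max 1 y * y ^ ((N : ℝ) / 2)) := by rw [Finset.sum_const, nsmul_eq_mul]
    _ ≤ 4 * (max 1 y * y ^ ((N : ℝ) / 2)) :=
        mul_le_mul_of_nonneg_right (by exact_mod_cast card_stripPairs_zero_le hN) hM

/-- **`min(1,y)·y^{N/2} ≤ C_{0,N}(y,1)`** (`y > 0`; the run to the right alone). [cite: BeatonBousquetMelouDeGierDuminilCopinGuttmann2014, §3.2 (arXiv v5 p. 10)] -/
theorem le_stripZ₀_zero (N : ℕ) (hy : 0 < y) : min 1 y * y ^ ((N : ℝ) / 2) ≤ stripZ₀ 0 N y := by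
  unfold stripZ₀
  calc min 1 y * y ^ ((N : ℝ) / 2) ≤ y ^ bottomVisits₀ (0 : Site 2) (lineWalk N) N :=
        (pow_bottomVisits₀_bounds (lineWalk_mem_stripPairs_zero N) hy).1
    _ ≤ ∑ p ∈ stripPairs 0 N, y ^ bottomVisits₀ p.1 p.2 N :=
        Finset.single_le_sum (f := fun p : Site 2 × (ℕ → Site 2) => y ^ bottomVisits₀ p.1 p.2 N)
          (fun p _ => pow_nonneg hy.le _) (lineWalk_mem_stripPairs_zero N)

/-- `c^{1/n} → 1` for a positive constant `c`. [folklore]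
[cite: BeatonBousquetMelouDeGierDuminilCopinGuttmann2014, §3.2 Proposition 6 (arXiv v5 p. 10: the growth rate μ_T(y,z) as a k-th-root limit of C_{T,k}(y,z)); elementary real analysis, lane plumbing] -/
theorem tendsto_const_rpow_one_div_nat₀ {c : ℝ} (hc : 0 < c) :
    Tendsto (fun n : ℕ => c ^ (1 / (n : ℝ))) atTop (𝓝 1) := by
  have h1 : Tendsto (fun n : ℕ => (1 : ℝ) / (n : ℝ)) atTop (𝓝 0) := tendsto_one_div_atTop_nhds_zero_nat
  have h2 : ContinuousAt (fun r : ℝ => c ^ r) 0 := Real.continuousAt_const_rpow hc.ne'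
  have h3 := h2.tendsto.comp h1
  simpa [Function.comp_def, Real.rpow_zero] using h3

/-- `(c·y^{N/2})^{1/N} = c^{1/N}·√y` for `N ≥ 1`. [folklore]
[cite: BeatonBousquetMelouDeGierDuminilCopinGuttmann2014, §3.2 Proposition 6 (arXiv v5 p. 10: the growth rate μ_T(y,z) as a k-th-root limit of C_{T,k}(y,z)); elementary real analysis, lane plumbing] -/
theorem rpow_half_root {c : ℝ} (hc : 0 ≤ c) (hy : 0 < y) (hN : 1 ≤ N) :
    (c * y ^ ((N : ℝ) / 2)) ^ (1 / (N : ℝ)) = c ^ (1 / (N : ℝ)) * Real.sqrt y := by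
  have hN' : (N : ℝ) ≠ 0 := by
    have : (1 : ℝ) ≤ N := by exact_mod_cast hN
    positivity
  rw [Real.mul_rpow hc (Real.rpow_nonneg hy.le _), ← Real.rpow_mul hy.le, Real.sqrt_eq_rpow]
  congr 2
  field_simp

/-- **`μ_0(y,1) = √y`** (`y > 0`): the growth rate of the one-row strip with the level-`0` weight — an exact value at the
bottom of the printed tower `μ_T(y,1)` (not in print). [cite: BeatonBousquetMelouDeGierDuminilCopinGuttmann2014, Proposition 6 (arXiv v5 p. 10: μ_T(y,z) = lim C_{T,n}(y,z)^{1/n}; the value for the narrowest strip is the lane's)] -/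
theorem stripMuY₀_zero (hy : 0 < y) : stripMuY₀ 0 y = Real.sqrt y := by
  have hlim := tendsto_stripZ₀_rpow 0 hy
  have hc1 : 0 < min 1 y := lt_min one_pos hy
  have hc2 : 0 < 4 * max 1 y := mul_pos (by norm_num) (one_pos.trans_le (le_max_left 1 y))
  have hlow : Tendsto (fun n : ℕ => (min 1 y * y ^ ((n : ℝ) / 2)) ^ (1 / (n : ℝ))) atTop (𝓝 (Real.sqrt y)) := by
    have h := (tendsto_const_rpow_one_div_nat₀ hc1).mul_const (Real.sqrt y)
    rw [one_mul] at h
    refine h.congr' ?_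
    filter_upwards [eventually_ge_atTop 1] with n hn
    exact (rpow_half_root hc1.le hy hn).symm
  have hupp : Tendsto (fun n : ℕ => (4 * max 1 y * y ^ ((n : ℝ) / 2)) ^ (1 / (n : ℝ))) atTop (𝓝 (Real.sqrt y)) := by
    have h := (tendsto_const_rpow_one_div_nat₀ hc2).mul_const (Real.sqrt y)
    rw [one_mul] at h
    refine h.congr' ?_
    filter_upwards [eventually_ge_atTop 1] with n hn
    exact (rpow_half_root hc2.le hy hn).symm
  refine tendsto_nhds_unique hlim (tendsto_of_tendsto_of_tendsto_of_le_of_le' hlow hupp ?_ ?_)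
  · filter_upwards [eventually_ge_atTop 1] with n hn
    exact Real.rpow_le_rpow (mul_nonneg hc1.le (Real.rpow_nonneg hy.le _)) (le_stripZ₀_zero n hy)
      (by positivity)
  · filter_upwards [eventually_ge_atTop 1] with n hn
    have h := stripZ₀_zero_le hn hy
    rw [← mul_assoc] at h
    exact Real.rpow_le_rpow (stripZ₀_pos 0 n hy).le h (by positivity)

end Literature.Probability.RandomPlanarGeometry.SAW.HexBW
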